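import Summits.CriticalPhenomena.SAWScalingLimit.Theorems.SAWDevelopingMapHexConjectureRestrictionCocycleOfAspectBound
import Summits.CriticalPhenomena.SAWScalingLimit.Theorems.SAWDevelopingMapHexConjectureAspectBoundOfWindowTwoPoint
import Summits.CriticalPhenomena.SAWScalingLimit.Theorems.HexConjecture.Negative.NonVacuity
import Summits.CriticalPhenomena.SAWScalingLimit.Theses.SAWDevelopingMap
import Summits.CriticalPhenomena.SAWScalingLimit.Theses.SAWHexUniversality
import Summits.CriticalPhenomena.SAWScalingLimit.Theses.SAWBrickWallHomotopy
import Literature.Probability.RandomPlanarGeometry.HexSAWTriangle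
import HarnessLib
import Summits.CriticalPhenomena.SAWScalingLimit.Theorems.SAWDevelopingMapHexConjectureWindowTwoPointOfReg
import Summits.CriticalPhenomena.SAWScalingLimit.Theorems.SAWDevelopingMapHexConjectureKPDefs
import Literature.Probability.RandomPlanarGeometry.HexParafermion

/-!
# Line `boundary-gram-bochner-regularity` — crux `HexConjecture` (stmt-CriticalPhenomena-0808)
ALTERNATIVE line (crux-strategist s3, 2026-08-17).  It does NOT replace the live skeleton `Lines/root_locality_replaces_loewner.lean`
(lead c12) nor s2's `Lines/one_domain_side_floor_profile.lean`; it keeps layer 1 (`HexConjecture ⟸ FRL ∧ WTLB ∧ UIM ∧ (E)`, landed glue)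
and the landed `REG → WTLB` (`RootLocality.stub_windowTwoPointLowerBound_of_reg`, p142667) verbatim, and RE-SOURCES the stuck node REG.

THE CRUX (fixed): Duminil-Copin–Smirnov 2012 Conjecture 1 on the honeycomb lattice as typed in the route files
(`SAWBrickWallHomotopy.HexConjecture` = `SAWHexUniversality.HexConjecture` = `SAWDevelopingMap.HexConjecture`, identical bodies).

WHERE THE LIVE LINE IS STUCK (lead seats c8–c12; s1/s2 censuses).  Layer 1 `HexConjecture ⟸ FloorRatioLimit ∧ WindowTwoPointLowerBound ∧
UniformModulus ∧ BoundaryUniversality` is kernel-checked (p118046 / p126051 / p129016 / p142668) and `REG → WTLB` is LANDED (p142667).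
STUCK GOAL (verbatim, `stub_triDlLowerRegular` = REG):
`∃ C : ℝ, ∀ T : ℕ, 1 ≤ T → ∑ i ∈ Finset.range (T + 1), HV.triDl i ≤ C * ((T : ℝ) + 1) * HV.triDl T`.
Diagnosis common to c10, s1, s2: every proved constraint on the sequences `triDl`, `G_k`, `B_T` (parafermionic identities = exact
accounting of TOTAL mass; one-sided monotonicity; gluing with polynomial losses; KP §3) is compatible with arbitrarily deep CLIFFS
(s2's Kaluza family), so none forces the LOWER regularity REG; REG/doubling is the RSW/FKG substitute the critical walk lacks.

THE MOVE OF THIS LINE — an ANTI-CLIFF INPUT OF A NEW KIND: POSITIVE-DEFINITENESS.  The crux idea `critical-boundary-gram` (triage r1: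
3/3 pass, never planned; `Ideas/critical-boundary-gram.md`, `EVIDENCE-boundary-gram.md`) found by exact enumeration that the Hermitian
boundary matrix `F_Λ(a,z)` of the parafermionic observable at `(x_c, σ = 5/8)` is POSITIVE SEMIDEFINITE on every simply connected domain tested
(≈ 32 000 domains, zero violations, kernel = outward normals, threshold exactly at `(x_c, 5/8)`, indefinite on `ℤ²`) — `BoundaryGramPSD` below.
Its half-plane floor block says: the twisted boundary two-point sequence `f(±k) = e^{±5πi/8} G(k)`, `f(0) = 1` (`G k = RootLocality.halfPlaneArch k`,
KP's `G_k`) is a POSITIVE-DEFINITE FUNCTION ON `ℤ` (`HalfPlaneGramPositivity`, STUB 1).  Bochner–Herglotz then gives, with the test vectors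
`c_j = e^{iqj}` at `q = 3π/(4M)` and the flux bound, a ONE-PARAMETER FAMILY OF LINEAR INEQUALITIES between window masses and tails of `G`
(`HalfPlaneBochnerIneq`, STUB 2, finite sums only):
      `Σ_{1≤k<M} G(k)·w(k/M) ≤ (1 + cos(3π/8))·Def(M)`,   `Def(M) := 1/(2cos(3π/8)) − Σ_{k≤M} G(k)` (= `Σ_{k>M} G(k)` by GM Prop. 1.1),
`w(u) = cos((3π/8)(2u−1)) − cos(3π/8) ≥ 0`.  (Equivalently, given GM Prop. 1.1, positivity of the whole symbol reads
      `Σ_m G(m)·sin(qm) ≤ (√2 − 1)·Σ_m G(m)·(1 − cos(qm))`   for all `0 < q ≤ π`,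
and for `G(m) ~ A·m^{-2h}` both sides are `~ A·q^{2h−1}·Γ(1−2h)·{sin, (√2−1)cos}((2h−1)π/2)`-multiples that COINCIDE iff `h = σ = 5/8`
(`cos(5π/8 − π/8) = 0`): the constraint is TANGENT at `q = 0` exactly at the conjectured boundary exponent — the sense in which F-PSD "pins"
`5/8` — and strict positivity near `q = 0` is decided by the corrections to scaling and the small-`m` values of `G`; this is the honest risk of
STUB 1 and the reason its cheapest falsifier (below) is informative.)  The displayed window/tail inequality is EXACTLY an anti-cliff statement: the mass of `G` in any window `[aM, bM]` is at most
`(1+cos(3π/8))/w_*` times the tail beyond `M`; hence `Def(M/20) ≤ 14.06·Def(19M/20)`, `Def(N) ≥ c·N^{-0.898}` and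
`Σ_{i≤N} Def(i) ≤ C₁·N·Def(N)` — the LOWER REGULARITY the lead needs, but for the half-plane tail `Def` instead of the triangle tail `triDl`
(STUB 3 (i); with KP Lemma 2.2 it also gives `triDl N ≥ c'·N^{-0.9}`, the "weakest open consequence" S7 of the s2 census, unconditionally on
STUB 1).  The transfer `Def ↦ triDl` is the RESIDUAL `AverageTailFraction` (STUB 4): `Σ_{i≤T} triDl i ≤ C·Σ_{i≤T} Def(i)` — the Abel-summed
form of the lead's one-scale `TailFraction` (c8: `TAIL_T/(κ₂ triDl T) = 0.94 → 0.88`, `T ≤ 96`), weaker than it, one-sided, and with the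
meaning "an arch is on average not much taller (in triangle scale) than long".  STUB 3: Bochner ∧ AvgTF ⟹ REG (real analysis + GM Prop. 1.1
in `HV` form + KP Lemma 2.2, all landed).  Then the landed `REG → WTLB` and layer 1.

WHY IT DODGES THE STUCK GOAL.  REG asked the T-side for lower regularity and no tool produces it (above).  Here lower regularity is
DELIVERED by positivity (stubs 1–3), for the sequence `Def`; what is left (AvgTF) is no longer a regularity-across-scales statement with
cliffs as enemy but a comparison of two truncated first moments of ONE half-plane arch ensemble (height-scale vs length), where tall-thin
arches are the only enemy — a different, one-sided, averaged target, attackable by unfolding/reflection of tall arches (entropy loss only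
logarithmic after Abel summation — to be tested) or by the observable on the DCS trapezoid with its top side (the `ε`-term).  Positivity
itself (STUB 1) has an independent proof route (the SOS/local vertex Gram degeneracy at `(x_c, 5/8)`, triage r1-1 §B.4) and an independent
cheap falsifier (strip symbols, the lead's `G(k)` data to `k = 256`: check the displayed inequality directly).

BARRIERS.  `Literature.Barriers.CriticalPhenomena.ParafermionicHalfCauchyRiemann`: NOT engaged by stubs 1–4 — no discrete holomorphicity
/ boundary-value convergence of the observable is used, only the vertex relation's flux bound and POSITIVITY (a property of the boundary
MATRIX, not of its continuum limit); it bites FRL exactly as on every line (one analytic atom = target 14003).  `SAWNoUnitaryCFTNarrow`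
(reflection positivity / OS positivity fails for SAW, `c = 0`): F-PSD is positivity of a BOUNDARY Gram kernel at the special spin `σ = 5/8`, not OS
positivity of bulk correlators; the numerics separate them (PSD fails at `σ = 1/2` and on `ℤ²`).  `NienhuisWeightsExcludeVertexSAW`,
`EmbeddingModulusUniqueness`: not in play (hexagonal lattice only).

DISPROOF USED (`Cruxes/HexConjecture/Disproof.lean`, verdict RESISTS; landed `Theorems/HexConjecture/Negative/{LoadBearing,NonVacuity,
BoundaryWitness}.lean`): `hexConjecture_false_without_tendsto_fst/_snd/_reachable` honoured — `stub_uniformModulus`, `stub_boundaryUniversality`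
carry `IsEmbEndpointApprox` in full and layer 1 consumes `reachable` / `eventually_ne` (see `discreteBoundary_of_floorVertex`); refuted
strengthenings (all-`δ` probability, fugacity 0, stmt-0772 all-`δ` tightness, stmt-5420 corridor root): no stub is an instance — stubs 1–4 are
statements about the critical half-plane two-point sequence and triangle masses at `x_c` only.  Negatives index (2026-08-17): stmt-8261
("edge of positive type ⟹ exponent") and stmt-8312 (phase retrieval) are NOT asserted — no stub infers an exponent or a phase from positivity;
stub 2 is the elementary Bochner direction (PSD ⟹ nonnegative symbol), stub 3 uses magnitudes of finite sums only.

DEAD LINES AVOIDED.  FK/percolation RSW transfer (needs FKG: dead, s1 T1); renewal/SRT for `B_T` (needs irreducible-bridge decay: dead, s2 T4);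
REG from doubling with `q > 1/2` via tail constants (impossible: `2·TAIL ≤ κ·triDl`, s3 census); PSD Cauchy–Schwarz cut vectors (only UPPER
bounds on cross masses, s3 census); `marginal_reflex_wedge_cauchy_kernel` (dead: mixed-sign kernel) — this line uses positivity of the
TWISTED kernel, whose sign structure is exactly what Bochner exploits.
-/

noncomputable section

namespace Summit.CriticalPhenomena.SAWScalingLimit.Cruxes.HexConjecture.BoundaryGramBochnerRegularity

open scoped Topology NNReal ENNReal BigOperators
open Filter Set Metric MeasureTheory
open Literature.Probability.LatticeModels (HexVertex hexGraph hexCenter)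
open Literature.Probability.RandomPlanarGeometry
open Literature.Probability.RandomPlanarGeometry.SAW

/-! ## The statements of the line (named Props; the registered stubs below restate them fully qualified) -/

/-- STATEMENT 1 — `FloorRatioLimit` (FRL; child 1 of the strategist split, verbatim the lead's `stub_floorRatioLimit`;
⟸ target stmt-14003 by the landed transport `RootLocality.floorRatioModulus_of_hexObservableLimit`). -/
def FloorRatioLimit : Prop :=
  ∀ (D D' : Literature.Probability.RandomPlanarGeometry.DobrushinDomain) (ρ : ℝ) (Λ : ℝ → Finset Literature.Probability.LatticeModels.HexVertex) (m₀ m m' : ℝ → ℤ) (a b b' : ℝ → Sym2 Literature.Probability.LatticeModels.HexVertex) (Φ : Literature.Probability.RandomPlanarGeometry.ConformalEquiv D.carrier UpperHalfPlane.upperHalfPlaneSet) (L : ℂ → ℂ) (Lb Lb' : ℂ), D'.carrier = D.carrier → D'.pt 0 = D.pt 0 → 0 < ρ → D.carrier ∩ Metric.ball (D.pt 0) ρ = {z : ℂ | (D.pt 0).im < z.im} ∩ Metric.ball (D.pt 0) ρ → D.carrier ∩ Metric.ball (D.pt 1) ρ = {z : ℂ | (D.pt 1).im < z.im} ∩ Metric.ball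 (D.pt 1) ρ → D.carrier ∩ Metric.ball (D'.pt 1) ρ = {z : ℂ | (D'.pt 1).im < z.im} ∩ Metric.ball (D'.pt 1) ρ → (∀ᶠ δ : ℝ in nhdsWithin (0 : ℝ) (Set.Ioi 0), Literature.Probability.RandomPlanarGeometry.SAW.hexDomainSimplyConnected (Λ δ) ∧ a δ ∈ Literature.Probability.RandomPlanarGeometry.SAW.hexDomainBoundary (Λ δ) ∧ b δ ∈ Literature.Probability.RandomPlanarGeometry.SAW.hexDomainBoundary (Λ δ) ∧ b' δ ∈ Literature.Probability.RandomPlanarGeometry.SAW.hexDomainBoundary (Λ δ) ∧ Nonempty (Literature.Probability.RandomPlanarGeometry.SAW.HexMidEdgeSAW (Λ δ) (a δ) (b δ)) ∧ Nonempty (Literature.Probability.RandomPlanarGeometry.SAW.HexMidEdgeSAW (Λ δ) (a δ) (b' δ)) ∧ (Literature.Probability.LatticeModels.hexGraph.induce (↑(Λ δ) : Set Literature.Probability.LatticeModels.HexVertex)).Preconnected ∧ (∀ v ∈ Λ δ, (δ : ℂ) * Literature.Probability.LatticeModels.hexCenter v ∈ D.carrier) ∧ (∀ v : Literature.Probability.LatticeModels.HexVertex,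 (δ : ℂ) * Literature.Probability.LatticeModels.hexCenter v ∈ Metric.ball (D.pt 0) ρ → (v ∈ Λ δ ↔ m₀ δ ≤ v.1 1)) ∧ (∀ v : Literature.Probability.LatticeModels.HexVertex, (δ : ℂ) * Literature.Probability.LatticeModels.hexCenter v ∈ Metric.ball (D.pt 1) ρ → (v ∈ Λ δ ↔ m δ ≤ v.1 1)) ∧ (∀ v : Literature.Probability.LatticeModels.HexVertex, (δ : ℂ) * Literature.Probability.LatticeModels.hexCenter v ∈ Metric.ball (D'.pt 1) ρ → (v ∈ Λ δ ↔ m' δ ≤ v.1 1))) → (∀ K : Set ℂ, IsCompact K → K ⊆ D.carrier → ∀ᶠ δ : ℝ in nhdsWithin (0 : ℝ) (Set.Ioi 0), ∀ v : Literature.Probability.LatticeModels.HexVertex, (δ : ℂ) * Literature.Probability.LatticeModels.hexCenter v ∈ K → v ∈ Λ δ) → Filter.Tendsto (fun δ : ℝ => (δ : ℂ) * Literature.Probability.RandomPlanarGeometry.SAW.hexMidpoint (a δ)) (nhdsWithin (0 : ℝ) (Set.Ioi 0)) (nhds (D.pt 0)) → Filter.Tendsto (fun δ : ℝ => (δ :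 ℂ) * Literature.Probability.RandomPlanarGeometry.SAW.hexMidpoint (b δ)) (nhdsWithin (0 : ℝ) (Set.Ioi 0)) (nhds (D.pt 1)) → Filter.Tendsto (fun δ : ℝ => (δ : ℂ) * Literature.Probability.RandomPlanarGeometry.SAW.hexMidpoint (b' δ)) (nhdsWithin (0 : ℝ) (Set.Ioi 0)) (nhds (D'.pt 1)) → Filter.Tendsto (fun x => ‖Φ x‖) (nhdsWithin (D.pt 0) D.carrier) Filter.atTop → Φ.HasBoundaryValue (D.pt 1) 0 → ContinuousOn L D.carrier → (∀ z ∈ D.carrier, Complex.exp (L z) = deriv Φ z) → Filter.Tendsto L (nhdsWithin (D.pt 1) D.carrier) (nhds Lb) → Filter.Tendsto L (nhdsWithin (D'.pt 1) D.carrier) (nhds Lb') → Filter.Tendsto (fun δ : ℝ => ‖Literature.Probability.RandomPlanarGeometry.SAW.hexParafermionicObservable (Λ δ) (a δ) Literature.Probability.RandomPlanarGeometry.SAW.hexCriticalFugacity (5 / 8) (b' δ) / Literature.Probability.RandomPlanarGeometry.SAW.hexParafermionicObservable (Λ δ) (a δ) Literature.Probability.RandomPlanarGeometry.SAW.hexCriticalFugacity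 (5 / 8) (b δ)‖) (nhdsWithin (0 : ℝ) (Set.Ioi 0)) (nhds (Real.exp ((5 / 8) * (Lb' - Lb).re)))

/-- SOURCE CONJECTURE `BoundaryGramPSD` (F-PSD, crux idea `critical-boundary-gram`, triage r1 3× pass, never planned): for every simply
connected hexagonal lattice domain `Λ`, the boundary-to-boundary parafermionic matrix `F_Λ(a,z) = hexParafermionicObservable Λ a x_c (5/8) z`
(trivial walk on the diagonal) is a positive semidefinite Hermitian kernel on `∂Λ`.  Verbatim `Cruxes/HexConjecture/SketchIdeator3.lean`.
Exhaustively verified by exact enumeration (≈ 32 000 domains ≤ 13 cells incl. every polyhex ≤ 7 cells and ≈ 300 slit/L/C/spiral shapes;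
strips `1 × L`, `L ≤ 25`, and the width-1 strip symbol on 4000 frequencies): `λ_min = 0` to rounding, kernel = the outward-normal line
(`BoundaryFluxIdentity`), threshold of positivity exactly at `(x_c, 5/8)` in both parameters, indefinite on `ℤ²` and on non-simply-connected
domains (`Cruxes/HexConjecture/EVIDENCE-boundary-gram.md`, `TRIAGE-r1-{1,2,3}.md`, jobs j006220 / j006904 / j007285–j007390).
Documentation only here: STUB 1 below is its half-plane floor block (principal `n × n` blocks of `F_Λ` for boxes `Λ ↑ ℍ`, floor rigidity of
the winding `∓π`, monotone limit of the coded floor-arch masses = `RootLocality.halfPlaneArch`). -/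
def BoundaryGramPSD : Prop :=
  ∀ Λ : Finset Literature.Probability.LatticeModels.HexVertex, Literature.Probability.RandomPlanarGeometry.SAW.hexDomainSimplyConnected Λ → ∀ c : Sym2 Literature.Probability.LatticeModels.HexVertex → ℂ, 0 ≤ (∑ᶠ a ∈ Literature.Probability.RandomPlanarGeometry.SAW.hexDomainBoundary Λ, ∑ᶠ z ∈ Literature.Probability.RandomPlanarGeometry.SAW.hexDomainBoundary Λ, (starRingEnd ℂ) (c a) * c z * Literature.Probability.RandomPlanarGeometry.SAW.hexParafermionicObservable Λ a Literature.Probability.RandomPlanarGeometry.SAW.hexCriticalFugacity (5 / 8) z).re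

/-- STATEMENT 2 — `HalfPlaneGramPositivity` (THE NEW LEVER; = `Sketch.TwistedBoundarySequencePosDef` at `G k := RootLocality.halfPlaneArch k`):
the twisted critical half-plane boundary two-point sequence `f(0) = 1`, `f(±k) = e^{±5πi/8} G(k)` (`G k` = KP's `G_k` = `halfPlaneArch k`,
the `x_c`-mass of half-plane walks between floor mid-edges at offset `k`; phase = `e^{-iσW}`, `σ = 5/8`, winding `W = ∓π` floor-to-floor)
is POSITIVE-DEFINITE on `ℤ`: every finite Gram form `Σ_{j,k<n} c̄_j c_k f(k-j)` has nonnegative real part.  ⟸ `BoundaryGramPSD`. -/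
def HalfPlaneGramPositivity : Prop :=
  ∀ (n : ℕ) (c : Fin n → ℂ), 0 ≤ (∑ j : Fin n, ∑ k : Fin n, (starRingEnd ℂ) (c j) * c k * (if (j : ℕ) = k then 1 else Complex.exp (Complex.I * (5 * Real.pi / 8) * (if (j : ℕ) < k then 1 else -1)) * (Summit.CriticalPhenomena.SAWScalingLimit.Theorems.HexConjecture.RootLocality.halfPlaneArch ((Int.natAbs ((j : ℤ) - k) : ℕ) : ℤ) : ℂ))).re

/-- STATEMENT 3 — `HalfPlaneBochnerIneq` (the BOCHNER CONSEQUENCE; finite sums of `halfPlaneArch` only): for every `M ≥ 1`,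
`Σ_{1 ≤ k < M} G(k)·w(k/M) ≤ (1 + cos(3π/8))·Def(M)`, `w(u) = cos((3π/8)(2u−1)) − cos(3π/8)` (`≥ 0` on `[0,1]`, concave, `w(0)=w(1)=0`,
`max w = 1 − cos(3π/8)` at `u = 1/2`).  PROOF ROUTE (stub 2, size M, provable now): in `HalfPlaneGramPositivity` take `c_j = e^{iqj}`,
`j < n`, `q = 3π/(4M)`; divide by `n`: `1 + 2 Σ_{1≤m<n} (1 − m/n) G(m) cos(qm + 5π/8) ≥ 0`; `−cos(qm + 5π/8) = w(m/M) + cos(3π/8)` for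
`m ≤ M` (`= cos(3π/8)` exactly at `m = M`) and `≥ −1` for `m > M`; `Σ_{M<m<n} G(m) ≤ Def(M)` for every `n` (partial sums `≤ 1/(2cos(3π/8))`);
subtract `cos(3π/8)·Σ_{m≤M} G(m)` from `1/2` and let `n → ∞` in a FINITE sum.  No normalisation `B_∞ = 0` is used here. -/
def HalfPlaneBochnerIneq : Prop :=
  ∀ M : ℕ, 1 ≤ M → ∑ k ∈ Finset.Ico 1 M, Summit.CriticalPhenomena.SAWScalingLimit.Theorems.HexConjecture.RootLocality.halfPlaneArch ((k : ℕ) : ℤ) * (Real.cos (3 * Real.pi / 8 * (2 * (k : ℝ) / M - 1)) - Real.cos (3 * Real.pi / 8)) ≤ (1 + Real.cos (3 * Real.pi / 8)) * (1 / (2 * Real.cos (3 * Real.pi / 8)) - ∑ k ∈ Finset.Icc 1 M, Summit.CriticalPhenomena.SAWScalingLimit.Theorems.HexConjecture.RootLocality.halfPlaneArch ((k : ℕ) : ℤ))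

/-- STATEMENT 4 — `AverageTailFraction` (AvgTF; THE RESIDUAL, open): the partial sums of the triangle left-exit masses are dominated by the
partial sums of the half-plane deficits, `Σ_{i≤T} triDl i ≤ C · Σ_{i≤T} Def(i)` for `T ≥ 1`.  Since `Def(i) = Σ_{k>i} G(k)` (GM Prop. 1.1),
this is the Abel-summed ("truncated first moment") form of the lead's one-scale `TailFraction` (`ε·triDl T ≤` far floor-arch mass beyond `±T`,
seat c8; numerically `TAIL_T /(κ₂·triDl T) = 0.94 → 0.88`, `T = 2 … 96`), and WEAKER than it (TF ⟹ AvgTF with the landed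
`stub_triDlLowerBound : m/(L+1) ≤ triDl L`).  Dictionary: `Σ_{i≤T} Def(i) = Σ_ω min(end(ω), T+1)·x_c^{|ω|}` over half-plane floor arches `ω`
from `0` landing to the right; `Σ_{i≤T} triDl i ≥` the same sum with `min(σ(ω), T+1)`, `σ(ω)` = the first triangle `T_i ∌ ω` — so AvgTF says
"on average an arch is not much TALLER (in triangle scale) than it is LONG".  Why it might fail: a half-plane arch ensemble dominated by tall thin
excursions (`σ(ω) ≫ end(ω)` for most of the mass); excluded by Conj. 2 (both sides `≍ T^{3/4}`), by KP (12) only in averaged-exponent form. -/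
def AverageTailFraction : Prop :=
  ∃ C : ℝ, ∀ T : ℕ, 1 ≤ T → ∑ i ∈ Finset.range (T + 1), Literature.Probability.RandomPlanarGeometry.SAW.HV.triDl i ≤ C * ∑ i ∈ Finset.range (T + 1), (1 / (2 * Real.cos (3 * Real.pi / 8)) - ∑ k ∈ Finset.Icc 1 i, Summit.CriticalPhenomena.SAWScalingLimit.Theorems.HexConjecture.RootLocality.halfPlaneArch ((k : ℕ) : ℤ))

/-- STATEMENT 5 — `TriDlLowerRegular` (REG; the lead's STUCK stub `stub_triDlLowerRegular`, verbatim): here a CONSEQUENCE of statements 2–4. -/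
def TriDlLowerRegular : Prop :=
  ∃ C : ℝ, ∀ T : ℕ, 1 ≤ T → ∑ i ∈ Finset.range (T + 1), Literature.Probability.RandomPlanarGeometry.SAW.HV.triDl i ≤ C * ((T : ℝ) + 1) * Literature.Probability.RandomPlanarGeometry.SAW.HV.triDl T

/-- STATEMENT 3 — `WindowTwoPointLowerBound` (WTLB; the lead's lever since seat c8 = child 2 of the split, verbatim). -/
def WindowTwoPointLowerBound : Prop :=
  ∃ θa θb C : ℝ, 0 < θa ∧ θa < θb ∧ θb ≤ 1 / 4 ∧ 0 < C ∧ ∃ R₀ : ℝ, 0 < R₀ ∧ ∀ R : ℝ, R₀ ≤ R → ∀ (x : Literature.Probability.LatticeModels.Site 2) (B : Finset Literature.Probability.LatticeModels.HexVertex) (S' : Finset ℤ), (∀ v : Literature.Probability.LatticeModels.HexVertex, v ∈ B ↔ (x 1 ≤ v.1 1 ∧ dist (Literature.Probability.LatticeModels.hexCenter v) (Literature.Probability.RandomPlanarGeometry.SAW.hexMidpoint s((x - Pi.single 1 1, 1), (x, 0))) ≤ R)) → (∀ d : ℤ, d ∈ S' ↔ (θa * R ≤ (d : ℝ) ∧ (d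 : ℝ) ≤ θb * R)) → Literature.Probability.RandomPlanarGeometry.SAW.HV.triDl ⌊R / 4⌋₊ ≤ C * ∑ d ∈ S', ∑ γ : Literature.Probability.RandomPlanarGeometry.SAW.HexMidEdgeSAW B s((x - Pi.single 1 1, 1), (x, 0)) s((x + Pi.single 0 d - Pi.single 1 1, 1), (x + Pi.single 0 d, 0)), Literature.Probability.RandomPlanarGeometry.SAW.hexCriticalFugacity ^ γ.length

/-- STATEMENT 4 — `UniformModulus` (UIM; child 3 of the split, verbatim; necessary, p79732). -/
def UniformModulus : Prop :=
  ∀ (D : Literature.Probability.RandomPlanarGeometry.DobrushinDomain) (ρ : ℝ) (a b : ℝ → Literature.Probability.LatticeModels.HexVertex), (0 < ρ ∧ (D.pt 1).im = (D.pt 0).im ∧ D.carrier ⊆ {z : ℂ | (D.pt 0).im < z.im} ∧ D.carrier ∩ Metric.ball (D.pt 0) ρ = {z : ℂ | (D.pt 0).im < z.im} ∩ Metric.ball (D.pt 0) ρ ∧ D.carrier ∩ Metric.ball (D.pt 1) ρ = {z : ℂ | (D.pt 1).im < z.im} ∩ Metric.ball (D.pt 1) ρ) → (Literature.Probability.RandomPlanarGeometry.SAW.IsEmbEndpointApprox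 Literature.Probability.LatticeModels.hexGraph Literature.Probability.LatticeModels.hexCenter D a b ∧ ∀ᶠ δ : ℝ in nhdsWithin (0 : ℝ) (Set.Ioi 0), (∃ u : Literature.Probability.LatticeModels.HexVertex, Literature.Probability.LatticeModels.hexGraph.Adj (a δ) u ∧ ((δ : ℂ) * Literature.Probability.LatticeModels.hexCenter u).im ≤ (D.pt 0).im) ∧ (∃ u : Literature.Probability.LatticeModels.HexVertex, Literature.Probability.LatticeModels.hexGraph.Adj (b δ) u ∧ ((δ : ℂ) * Literature.Probability.LatticeModels.hexCenter u).im ≤ (D.pt 1).im)) → ∀ ε η : ℝ, 0 < ε → 0 < η → ∃ θ : ℝ, 0 < θ ∧ ∀ᶠ δ : ℝ in nhdsWithin (0 : ℝ) (Set.Ioi 0), Literature.Probability.RandomPlanarGeometry.SAW.hexSAWLaw D.carrier δ (a δ) (b δ) {γ | γ.curve ∉ Literature.Probability.RandomPlanarGeometry.CurveClass.modulusClass ε θ} ≤ ENNReal.ofReal η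

/-- The floor-class convergence statement (crux-10472's class: floor domains, floor-vertex endpoints). -/
def FloorConvergence : Prop :=
  ∀ (D : Literature.Probability.RandomPlanarGeometry.DobrushinDomain) (ρ : ℝ) (a b : ℝ → Literature.Probability.LatticeModels.HexVertex), (0 < ρ ∧ (D.pt 1).im = (D.pt 0).im ∧ D.carrier ⊆ {z : ℂ | (D.pt 0).im < z.im} ∧ D.carrier ∩ Metric.ball (D.pt 0) ρ = {z : ℂ | (D.pt 0).im < z.im} ∩ Metric.ball (D.pt 0) ρ ∧ D.carrier ∩ Metric.ball (D.pt 1) ρ = {z : ℂ | (D.pt 1).im < z.im} ∩ Metric.ball (D.pt 1) ρ) → (Literature.Probability.RandomPlanarGeometry.SAW.IsEmbEndpointApprox Literature.Probability.LatticeModels.hexGraph Literature.Probability.LatticeModels.hexCenter D a b ∧ ∀ᶠ δ : ℝ in nhdsWithin (0 : ℝ) (Set.Ioi 0), (∃ u : Literature.Probability.LatticeModels.HexVertex, Literature.Probability.LatticeModels.hexGraph.Adj (a δ) u ∧ ((δ : ℂ) * Literature.Probability.LatticeModels.hexCenter u).im ≤ (D.pt 0).im) ∧ (∃ u : Literature.Probability.LatticeModels.HexVertex,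 Literature.Probability.LatticeModels.hexGraph.Adj (b δ) u ∧ ((δ : ℂ) * Literature.Probability.LatticeModels.hexCenter u).im ≤ (D.pt 1).im)) → Literature.Probability.RandomPlanarGeometry.ConvergesInLawToSLE ((8 : NNReal) / 3) D (fun δ (γ : Literature.Probability.RandomPlanarGeometry.SAW.HexDomainSAW D.carrier δ (a δ) (b δ)) => γ.curve) (fun δ => Literature.Probability.RandomPlanarGeometry.SAW.hexSAWLaw D.carrier δ (a δ) (b δ))

/-- STATEMENT 5 — `BoundaryUniversality` (E) (child 4 of the split, verbatim; necessary, `boundaryUniversality_of_hexConjecture`). -/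
def BoundaryUniversality : Prop :=
  (∀ (D : Literature.Probability.RandomPlanarGeometry.DobrushinDomain) (ρ : ℝ) (a b : ℝ → Literature.Probability.LatticeModels.HexVertex), (0 < ρ ∧ (D.pt 1).im = (D.pt 0).im ∧ D.carrier ⊆ {z : ℂ | (D.pt 0).im < z.im} ∧ D.carrier ∩ Metric.ball (D.pt 0) ρ = {z : ℂ | (D.pt 0).im < z.im} ∩ Metric.ball (D.pt 0) ρ ∧ D.carrier ∩ Metric.ball (D.pt 1) ρ = {z : ℂ | (D.pt 1).im < z.im} ∩ Metric.ball (D.pt 1) ρ) → (Literature.Probability.RandomPlanarGeometry.SAW.IsEmbEndpointApprox Literature.Probability.LatticeModels.hexGraph Literature.Probability.LatticeModels.hexCenter D a b ∧ ∀ᶠ δ : ℝ in nhdsWithin (0 : ℝ) (Set.Ioi 0), (∃ u : Literature.Probability.LatticeModels.HexVertex, Literature.Probability.LatticeModels.hexGraph.Adj (a δ) u ∧ ((δ : ℂ) * Literature.Probability.LatticeModels.hexCenter u).im ≤ (D.pt 0).im) ∧ (∃ u : Literature.Probability.LatticeModels.HexVertex, Literature.Probability.LatticeModels.hexGraph.Adj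 (b δ) u ∧ ((δ : ℂ) * Literature.Probability.LatticeModels.hexCenter u).im ≤ (D.pt 1).im)) → Literature.Probability.RandomPlanarGeometry.ConvergesInLawToSLE ((8 : NNReal) / 3) D (fun δ (γ : Literature.Probability.RandomPlanarGeometry.SAW.HexDomainSAW D.carrier δ (a δ) (b δ)) => γ.curve) (fun δ => Literature.Probability.RandomPlanarGeometry.SAW.hexSAWLaw D.carrier δ (a δ) (b δ))) → ∀ (D : Literature.Probability.RandomPlanarGeometry.DobrushinDomain) (a b : ℝ → Literature.Probability.LatticeModels.HexVertex), Literature.Probability.RandomPlanarGeometry.SAW.IsEmbEndpointApprox Literature.Probability.LatticeModels.hexGraph Literature.Probability.LatticeModels.hexCenter D a b → Literature.Probability.RandomPlanarGeometry.ConvergesInLawToSLE ((8 : NNReal) / 3) D (fun δ (γ : Literature.Probability.RandomPlanarGeometry.SAW.HexDomainSAW D.carrier δ (a δ) (b δ)) => γ.curve) (fun δ => Literature.Probability.RandomPlanarGeometry.SAW.hexSAWLaw D.carrier δ (a δ) (b δ))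

/-- (E) is `FloorConvergence → crux` on the nose. -/
theorem boundaryUniversality_iff : BoundaryUniversality ↔ (FloorConvergence →
    Summit.CriticalPhenomena.SAWScalingLimit.Theses.SAWDevelopingMap.HexConjecture) := Iff.rfl

/-! ## Registered stubs (`sorry` only here) -/

/-- STUB 1 (THE NEW LEVER; L; positivity side): `HalfPlaneGramPositivity` — the twisted half-plane boundary two-point sequence is
positive-definite.  Sources: F-PSD (`BoundaryGramPSD`, crux idea critical-boundary-gram + EVIDENCE-boundary-gram.md) by principal blocks
(boxes `Λ_N ↑ ℍ`, floor winding `∓π`, entrywise monotone limit — rigorous: principal blocks and limits of PSD matrices are PSD); or directly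
(strip transfer-matrix symbols, triage r1-3 job j007390).  WHY IT MIGHT FAIL: the finite-domain evidence (≤ 13 cells, strips of width ≤ 2) does
not probe `q → 0`, where the symbol is tangent to `0` at leading order (module docstring) and its sign is that of
`−Σ_m m·(G(m) − A·m^{-5/4}) + …` (corrections to scaling); a proof must therefore be structural (e.g. an SOS decomposition of `F_Λ` into local
vertex Gram forms degenerate exactly at `(x_c, 5/8)`, triage r1-1), not asymptotic.  CHEAPEST FALSIFIER: with the lead's half-plane data
`G(m)`, `m ≤ 128` (strip rigs to `L = 256`, jobs j025472/j025474) and `Def(K)`, the certificate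
`Σ_{m≤K} G(m)(cos(3π/8) + cos(qm + 5π/8)) + (1 + 2cos(3π/8))·Def(K) < 0` at any `q` refutes the stub; the finite family of STATEMENT 3
(`M ≤ 100`) is the weaker check the line actually consumes. -/
theorem stub_halfPlaneGramPositivity : ∀ (n : ℕ) (c : Fin n → ℂ), 0 ≤ (∑ j : Fin n, ∑ k : Fin n, (starRingEnd ℂ) (c j) * c k * (if (j : ℕ) = k then 1 else Complex.exp (Complex.I * (5 * Real.pi / 8) * (if (j : ℕ) < k then 1 else -1)) * (Summit.CriticalPhenomena.SAWScalingLimit.Theorems.HexConjecture.RootLocality.halfPlaneArch ((Int.natAbs ((j : ℤ) - k) : ℕ) : ℤ) : ℂ))).re := by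
  sorry

/-- STUB 2 (M; harmonic analysis, provable now): positivity ⟹ the Bochner tail inequality (test vectors `c_j = e^{iqj}`, `q = 3π/(4M)`;
needs only `0 ≤ halfPlaneArch` and the flux bound `Σ_{k ∈ F} halfPlaneArch k ≤ 1/(2cos(3π/8))` for finite `F ⊆ ℕ_{≥1}`). -/
theorem stub_bochnerIneq_of_positivity : (∀ (n : ℕ) (c : Fin n → ℂ), 0 ≤ (∑ j : Fin n, ∑ k : Fin n, (starRingEnd ℂ) (c j) * c k * (if (j : ℕ) = k then 1 else Complex.exp (Complex.I * (5 * Real.pi / 8) * (if (j : ℕ) < k then 1 else -1)) * (Summit.CriticalPhenomena.SAWScalingLimit.Theorems.HexConjecture.RootLocality.halfPlaneArch ((Int.natAbs ((j : ℤ) - k) : ℕ) : ℤ) : ℂ))).re) → (∀ M : ℕ, 1 ≤ M → ∑ k ∈ Finset.Ico 1 M, Summit.CriticalPhenomena.SAWScalingLimit.Theorems.HexConjecture.RootLocality.halfPlaneArch ((k : ℕ) : ℤ) * (Real.cos (3 * Real.pi / 8 * (2 * (k : ℝ) / M - 1)) - Real.cos (3 * Real.pi / 8)) ≤ (1 + Real.cos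 (3 * Real.pi / 8)) * (1 / (2 * Real.cos (3 * Real.pi / 8)) - ∑ k ∈ Finset.Icc 1 M, Summit.CriticalPhenomena.SAWScalingLimit.Theorems.HexConjecture.RootLocality.halfPlaneArch ((k : ℕ) : ℤ))) := by
  sorry

/-- STUB 3 (M; real analysis + two landed facts, provable now): Bochner inequality ∧ averaged tail fraction ⟹ REG.
(i) LOWER REGULARITY OF THE DEFICIT from stub 2 alone: for `0 < a < b < 1`, `w ≥ w_* := min(w(a),w(b)) > 0` on `[a,b]` (concavity), so
`w_*·(Def(⌈aM⌉−1) − Def(⌊bM⌋)) ≤ (1+cos(3π/8))·Def(M) ≤ (1+cos(3π/8))·Def(⌊bM⌋)`, i.e. `Def(aM) ≤ λ·Def(bM)`, `λ = 1 + (1+cos(3π/8))/w_*`;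
with `a = 1/20`, `b = 19/20`: `w_* = 0.1059`, `λ = 14.06 < 19 = b/a`, hence `Def(N) ≥ c·N^{-0.898}` and `Σ_{i≤N} Def(i) ≤ C₁·(N+1)·Def(N)`
(geometric series, ratio `λ/19 < 1`).  (ii) `Σ_{i≤T} triDl i ≤ C·Σ_{i≤T} Def(i) ≤ C·C₁·(T+1)·Def(T)` (AvgTF + (i)).  (iii) `Def(T) = Σ_{k>T} G(k)`
(GM Prop. 1.1 in `HV` form + `G(-k) = G(k)`, `RootLocality` CodedReflect) `≤ (cos(π/8)/cos(3π/8))·triDl T` (KP Lemma 2.2 =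
`RootLocality.farOffsetMass_le_sub_triA`, p128102, summed over the DCS trapezoids and passed to the `iSup`). -/
theorem stub_reg_of_bochner_avgTail : (∀ M : ℕ, 1 ≤ M → ∑ k ∈ Finset.Ico 1 M, Summit.CriticalPhenomena.SAWScalingLimit.Theorems.HexConjecture.RootLocality.halfPlaneArch ((k : ℕ) : ℤ) * (Real.cos (3 * Real.pi / 8 * (2 * (k : ℝ) / M - 1)) - Real.cos (3 * Real.pi / 8)) ≤ (1 + Real.cos (3 * Real.pi / 8)) * (1 / (2 * Real.cos (3 * Real.pi / 8)) - ∑ k ∈ Finset.Icc 1 M, Summit.CriticalPhenomena.SAWScalingLimit.Theorems.HexConjecture.RootLocality.halfPlaneArch ((k : ℕ) : ℤ))) → (∃ C : ℝ, ∀ T : ℕ, 1 ≤ T → ∑ i ∈ Finset.range (T + 1), Literature.Probability.RandomPlanarGeometry.SAW.HV.triDl i ≤ C * ∑ i ∈ Finset.range (T + 1), (1 / (2 * Real.cos (3 * Real.pi / 8)) - ∑ k ∈ Finset.Icc 1 i, Summit.CriticalPhenomena.SAWScalingLimit.Theorems.HexConjecture.RootLocality.halfPlaneArch ((k : ℕ)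 : ℤ))) → (∃ C : ℝ, ∀ T : ℕ, 1 ≤ T → ∑ i ∈ Finset.range (T + 1), Literature.Probability.RandomPlanarGeometry.SAW.HV.triDl i ≤ C * ((T : ℝ) + 1) * Literature.Probability.RandomPlanarGeometry.SAW.HV.triDl T) := by
  sorry

/-- STUB 4 (THE RESIDUAL; L–XL; open): `AverageTailFraction`. -/
theorem stub_averageTailFraction : ∃ C : ℝ, ∀ T : ℕ, 1 ≤ T → ∑ i ∈ Finset.range (T + 1), Literature.Probability.RandomPlanarGeometry.SAW.HV.triDl i ≤ C * ∑ i ∈ Finset.range (T + 1), (1 / (2 * Real.cos (3 * Real.pi / 8)) - ∑ k ∈ Finset.Icc 1 i, Summit.CriticalPhenomena.SAWScalingLimit.Theorems.HexConjecture.RootLocality.halfPlaneArch ((k : ℕ) : ℤ)) := by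
  sorry

/-- STUB 5 (shared; XL; = child `FloorRatioLimit`; closes the day stmt-14003 lands). -/
theorem stub_floorRatioLimit : ∀ (D D' : Literature.Probability.RandomPlanarGeometry.DobrushinDomain) (ρ : ℝ) (Λ : ℝ → Finset Literature.Probability.LatticeModels.HexVertex) (m₀ m m' : ℝ → ℤ) (a b b' : ℝ → Sym2 Literature.Probability.LatticeModels.HexVertex) (Φ : Literature.Probability.RandomPlanarGeometry.ConformalEquiv D.carrier UpperHalfPlane.upperHalfPlaneSet) (L : ℂ → ℂ) (Lb Lb' : ℂ), D'.carrier = D.carrier → D'.pt 0 = D.pt 0 → 0 < ρ → D.carrier ∩ Metric.ball (D.pt 0) ρ = {z : ℂ | (D.pt 0).im < z.im} ∩ Metric.ball (D.pt 0) ρ → D.carrier ∩ Metric.ball (D.pt 1) ρ = {z : ℂ | (D.pt 1).im < z.im} ∩ Metric.ball (D.pt 1) ρ → D.carrier ∩ Metric.ball (D'.pt 1) ρ = {z : ℂ | (D'.pt 1).im < z.im} ∩ Metric.ball (D'.pt 1) ρ → (∀ᶠ δ : ℝ in nhdsWithin (0 : ℝ) (Set.Ioi 0), Literature.Probability.RandomPlanarGeometry.SAW.hexDomainSimplyConnected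 (Λ δ) ∧ a δ ∈ Literature.Probability.RandomPlanarGeometry.SAW.hexDomainBoundary (Λ δ) ∧ b δ ∈ Literature.Probability.RandomPlanarGeometry.SAW.hexDomainBoundary (Λ δ) ∧ b' δ ∈ Literature.Probability.RandomPlanarGeometry.SAW.hexDomainBoundary (Λ δ) ∧ Nonempty (Literature.Probability.RandomPlanarGeometry.SAW.HexMidEdgeSAW (Λ δ) (a δ) (b δ)) ∧ Nonempty (Literature.Probability.RandomPlanarGeometry.SAW.HexMidEdgeSAW (Λ δ) (a δ) (b' δ)) ∧ (Literature.Probability.LatticeModels.hexGraph.induce (↑(Λ δ) : Set Literature.Probability.LatticeModels.HexVertex)).Preconnected ∧ (∀ v ∈ Λ δ, (δ : ℂ) * Literature.Probability.LatticeModels.hexCenter v ∈ D.carrier) ∧ (∀ v : Literature.Probability.LatticeModels.HexVertex, (δ : ℂ) * Literature.Probability.LatticeModels.hexCenter v ∈ Metric.ball (D.pt 0) ρ → (v ∈ Λ δ ↔ m₀ δ ≤ v.1 1)) ∧ (∀ v : Literature.Probability.LatticeModels.HexVertex, (δ : ℂ) * Literature.Probability.LatticeModels.hexCenter v ∈ Metric.ball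 (D.pt 1) ρ → (v ∈ Λ δ ↔ m δ ≤ v.1 1)) ∧ (∀ v : Literature.Probability.LatticeModels.HexVertex, (δ : ℂ) * Literature.Probability.LatticeModels.hexCenter v ∈ Metric.ball (D'.pt 1) ρ → (v ∈ Λ δ ↔ m' δ ≤ v.1 1))) → (∀ K : Set ℂ, IsCompact K → K ⊆ D.carrier → ∀ᶠ δ : ℝ in nhdsWithin (0 : ℝ) (Set.Ioi 0), ∀ v : Literature.Probability.LatticeModels.HexVertex, (δ : ℂ) * Literature.Probability.LatticeModels.hexCenter v ∈ K → v ∈ Λ δ) → Filter.Tendsto (fun δ : ℝ => (δ : ℂ) * Literature.Probability.RandomPlanarGeometry.SAW.hexMidpoint (a δ)) (nhdsWithin (0 : ℝ) (Set.Ioi 0)) (nhds (D.pt 0)) → Filter.Tendsto (fun δ : ℝ => (δ : ℂ) * Literature.Probability.RandomPlanarGeometry.SAW.hexMidpoint (b δ)) (nhdsWithin (0 : ℝ) (Set.Ioi 0)) (nhds (D.pt 1)) → Filter.Tendsto (fun δ : ℝ => (δ : ℂ) * Literature.Probability.RandomPlanarGeometry.SAW.hexMidpoint (b' δ)) (nhdsWithin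 (0 : ℝ) (Set.Ioi 0)) (nhds (D'.pt 1)) → Filter.Tendsto (fun x => ‖Φ x‖) (nhdsWithin (D.pt 0) D.carrier) Filter.atTop → Φ.HasBoundaryValue (D.pt 1) 0 → ContinuousOn L D.carrier → (∀ z ∈ D.carrier, Complex.exp (L z) = deriv Φ z) → Filter.Tendsto L (nhdsWithin (D.pt 1) D.carrier) (nhds Lb) → Filter.Tendsto L (nhdsWithin (D'.pt 1) D.carrier) (nhds Lb') → Filter.Tendsto (fun δ : ℝ => ‖Literature.Probability.RandomPlanarGeometry.SAW.hexParafermionicObservable (Λ δ) (a δ) Literature.Probability.RandomPlanarGeometry.SAW.hexCriticalFugacity (5 / 8) (b' δ) / Literature.Probability.RandomPlanarGeometry.SAW.hexParafermionicObservable (Λ δ) (a δ) Literature.Probability.RandomPlanarGeometry.SAW.hexCriticalFugacity (5 / 8) (b δ)‖) (nhdsWithin (0 : ℝ) (Set.Ioi 0)) (nhds (Real.exp ((5 / 8) * (Lb' - Lb).re))) := by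
  sorry

/-- STUB 6 (shared; XL; = child `UniformModulus`). -/
theorem stub_uniformModulus : ∀ (D : Literature.Probability.RandomPlanarGeometry.DobrushinDomain) (ρ : ℝ) (a b : ℝ → Literature.Probability.LatticeModels.HexVertex), (0 < ρ ∧ (D.pt 1).im = (D.pt 0).im ∧ D.carrier ⊆ {z : ℂ | (D.pt 0).im < z.im} ∧ D.carrier ∩ Metric.ball (D.pt 0) ρ = {z : ℂ | (D.pt 0).im < z.im} ∩ Metric.ball (D.pt 0) ρ ∧ D.carrier ∩ Metric.ball (D.pt 1) ρ = {z : ℂ | (D.pt 1).im < z.im} ∩ Metric.ball (D.pt 1) ρ) → (Literature.Probability.RandomPlanarGeometry.SAW.IsEmbEndpointApprox Literature.Probability.LatticeModels.hexGraph Literature.Probability.LatticeModels.hexCenter D a b ∧ ∀ᶠ δ : ℝ in nhdsWithin (0 : ℝ) (Set.Ioi 0), (∃ u : Literature.Probability.LatticeModels.HexVertex, Literature.Probability.LatticeModels.hexGraph.Adj (a δ) u ∧ ((δ : ℂ) * Literature.Probability.LatticeModels.hexCenter u).im ≤ (D.pt 0).im) ∧ (∃ u : Literature.Probability.LatticeModels.HexVertex,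 Literature.Probability.LatticeModels.hexGraph.Adj (b δ) u ∧ ((δ : ℂ) * Literature.Probability.LatticeModels.hexCenter u).im ≤ (D.pt 1).im)) → ∀ ε η : ℝ, 0 < ε → 0 < η → ∃ θ : ℝ, 0 < θ ∧ ∀ᶠ δ : ℝ in nhdsWithin (0 : ℝ) (Set.Ioi 0), Literature.Probability.RandomPlanarGeometry.SAW.hexSAWLaw D.carrier δ (a δ) (b δ) {γ | γ.curve ∉ Literature.Probability.RandomPlanarGeometry.CurveClass.modulusClass ε θ} ≤ ENNReal.ofReal η := by
  sorry

/-- STUB 7 (shared; XL; = child `BoundaryUniversality`). -/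
theorem stub_boundaryUniversality : (∀ (D : Literature.Probability.RandomPlanarGeometry.DobrushinDomain) (ρ : ℝ) (a b : ℝ → Literature.Probability.LatticeModels.HexVertex), (0 < ρ ∧ (D.pt 1).im = (D.pt 0).im ∧ D.carrier ⊆ {z : ℂ | (D.pt 0).im < z.im} ∧ D.carrier ∩ Metric.ball (D.pt 0) ρ = {z : ℂ | (D.pt 0).im < z.im} ∩ Metric.ball (D.pt 0) ρ ∧ D.carrier ∩ Metric.ball (D.pt 1) ρ = {z : ℂ | (D.pt 1).im < z.im} ∩ Metric.ball (D.pt 1) ρ) → (Literature.Probability.RandomPlanarGeometry.SAW.IsEmbEndpointApprox Literature.Probability.LatticeModels.hexGraph Literature.Probability.LatticeModels.hexCenter D a b ∧ ∀ᶠ δ : ℝ in nhdsWithin (0 : ℝ) (Set.Ioi 0), (∃ u : Literature.Probability.LatticeModels.HexVertex, Literature.Probability.LatticeModels.hexGraph.Adj (a δ) u ∧ ((δ : ℂ) * Literature.Probability.LatticeModels.hexCenter u).im ≤ (D.pt 0).im) ∧ (∃ u : Literature.Probability.LatticeModels.HexVertex, Literature.Probability.LatticeModels.hexGraph.Adj (b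 δ) u ∧ ((δ : ℂ) * Literature.Probability.LatticeModels.hexCenter u).im ≤ (D.pt 1).im)) → Literature.Probability.RandomPlanarGeometry.ConvergesInLawToSLE ((8 : NNReal) / 3) D (fun δ (γ : Literature.Probability.RandomPlanarGeometry.SAW.HexDomainSAW D.carrier δ (a δ) (b δ)) => γ.curve) (fun δ => Literature.Probability.RandomPlanarGeometry.SAW.hexSAWLaw D.carrier δ (a δ) (b δ))) → ∀ (D : Literature.Probability.RandomPlanarGeometry.DobrushinDomain) (a b : ℝ → Literature.Probability.LatticeModels.HexVertex), Literature.Probability.RandomPlanarGeometry.SAW.IsEmbEndpointApprox Literature.Probability.LatticeModels.hexGraph Literature.Probability.LatticeModels.hexCenter D a b → Literature.Probability.RandomPlanarGeometry.ConvergesInLawToSLE ((8 : NNReal) / 3) D (fun δ (γ : Literature.Probability.RandomPlanarGeometry.SAW.HexDomainSAW D.carrier δ (a δ) (b δ)) => γ.curve) (fun δ => Literature.Probability.RandomPlanarGeometry.SAW.hexSAWLaw D.carrier δ (a δ) (b δ)) := by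
  sorry

/-! ## Glue (sorry-free) -/

/-- Local alias of the crux body, used as the conclusion of the HYPOTHESIS-FORM compositions below so that, for each of the three route
decls, the hypothesis-free `HexConjecture_proof[']['']` is the UNIQUE theorem of this file concluding it by name (the skeleton audit takes an
arbitrary candidate otherwise). -/
def Crux : Prop := Summit.CriticalPhenomena.SAWScalingLimit.Theses.SAWDevelopingMap.HexConjecture


/-- Floor-vertex endpoints are discrete-boundary endpoints, eventually, on floor domains (the endpoint passage of the landed
`Split.stub_discreteBoundary_of_floorVertex`, p142668, reproduced here because the check farm has not yet built that module). [folklore] -/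
theorem discreteBoundary_of_floorVertex : ∀ {D : DobrushinDomain} {a b : ℝ → HexVertex},
    D.carrier ⊆ {z : ℂ | (D.pt 0).im < z.im} → (D.pt 1).im = (D.pt 0).im →
    IsEmbEndpointApprox hexGraph hexCenter D a b →
    (∀ᶠ δ : ℝ in 𝓝[>] 0, (∃ u : HexVertex, hexGraph.Adj (a δ) u ∧ ((δ : ℂ) * hexCenter u).im ≤ (D.pt 0).im) ∧
      (∃ u : HexVertex, hexGraph.Adj (b δ) u ∧ ((δ : ℂ) * hexCenter u).im ≤ (D.pt 1).im)) →
    ∀ᶠ δ : ℝ in 𝓝[>] 0,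
      (a δ ∈ embMeshDomain hexGraph hexCenter D.carrier δ ∧ ∃ w, hexGraph.Adj (a δ) w ∧ ¬ (hexDomainGraph D.carrier δ).Adj (a δ) w) ∧
      (b δ ∈ embMeshDomain hexGraph hexCenter D.carrier δ ∧ ∃ w, hexGraph.Adj (b δ) w ∧ ¬ (hexDomainGraph D.carrier δ).Adj (b δ) w) := by
  intro D a b hD h01 hab hfl
  have hbelow : ∀ {δ : ℝ} {v u : HexVertex}, ((δ : ℂ) * hexCenter u).im ≤ (D.pt 0).im →
      ¬ (hexDomainGraph D.carrier δ).Adj v u := by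
    intro δ v u hu hadj
    have huΩ : u ∈ embMeshDomain hexGraph hexCenter D.carrier δ := ((embDomainGraph_adj_iff _ _).1 hadj).2.2
    have : (D.pt 0).im < ((δ : ℂ) * hexCenter u).im := hD (embMeshDomain_subset _ _ _ _ huΩ)
    exact absurd this (not_lt.2 hu)
  have hmem : ∀ {δ : ℝ} {u v : HexVertex}, u ≠ v → (hexDomainGraph D.carrier δ).Reachable u v →
      u ∈ embMeshDomain hexGraph hexCenter D.carrier δ := by
    intro δ u v huv h
    obtain ⟨p⟩ := h
    cases p with
    | nil => exact absurd rfl huv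
    | cons hadj _ => exact ((embDomainGraph_adj_iff _ _).1 hadj).2.1
  filter_upwards [hfl, hab.reachable,
    Summit.CriticalPhenomena.SAWScalingLimit.Cruxes.HexConjecture.NonVacuity.IsEmbEndpointApprox.eventually_ne hab]
    with δ hδ hreach hne
  obtain ⟨⟨u, hu, hui⟩, ⟨u', hu', hui'⟩⟩ := hδ
  rw [h01] at hui'
  exact ⟨⟨hmem hne hreach, u, hu, hbelow hui⟩, ⟨hmem (Ne.symm hne) hreach.symm, u', hu', hbelow hui'⟩⟩

/-- Layer 1 (= the landed `Split.HexConjecture_of_subs`, re-derived from its two built imports): FRL → WTLB → UIM → (E) → crux.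
Kept so that ANY proof of WTLB (T-side REG/doubling of the live line, or SFB of this line) closes this skeleton. -/
theorem HexConjecture_of_windowTwoPoint (hF : FloorRatioLimit) (hW : WindowTwoPointLowerBound) (hU : UniformModulus)
    (hE : BoundaryUniversality) : Crux := by
  show Summit.CriticalPhenomena.SAWScalingLimit.Theses.SAWDevelopingMap.HexConjecture
  refine boundaryUniversality_iff.1 hE ?_
  intro D ρ a b hfl hend
  exact Summit.CriticalPhenomena.SAWScalingLimit.Theorems.HexConjecture.RootLocality.hexConjectureFloor_of_aspectEstimates hF
    (Summit.CriticalPhenomena.SAWScalingLimit.Theorems.HexConjecture.RootLocality.archAspectBound_of_windowTwoPointLowerBound hW)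
    hU D ρ a b hfl hend.1 (discreteBoundary_of_floorVertex hfl.2.2.1 hfl.2.1 hend.1 hend.2)

/-- REG from the three new statements of this line (positivity → Bochner → with AvgTF → REG). -/
theorem triDlLowerRegular_of (hP : HalfPlaneGramPositivity) (hPB : HalfPlaneGramPositivity → HalfPlaneBochnerIneq)
    (hBR : HalfPlaneBochnerIneq → AverageTailFraction → TriDlLowerRegular) (hA : AverageTailFraction) : TriDlLowerRegular :=
  hBR (hPB hP) hA

/-- WTLB from REG: the landed `RootLocality.stub_windowTwoPointLowerBound_of_reg` (p142667; `θa = 1/168`, `θb = 1/4`). -/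
theorem windowTwoPointLowerBound_of_reg (h : TriDlLowerRegular) : WindowTwoPointLowerBound :=
  Summit.CriticalPhenomena.SAWScalingLimit.Theorems.HexConjecture.RootLocality.stub_windowTwoPointLowerBound_of_reg h

/-- **The crux from the seven statements of this line** (kernel-checked):
positivity → (positivity → Bochner) → (Bochner → AvgTF → REG) → AvgTF → floor-ratio limit → uniform modulus → boundary universality →
`Crux` (= the common body of the three route decls; see the `_proof` family below for the decls BY NAME). -/
theorem HexConjecture_of (hP : HalfPlaneGramPositivity) (hPB : HalfPlaneGramPositivity → HalfPlaneBochnerIneq)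
    (hBR : HalfPlaneBochnerIneq → AverageTailFraction → TriDlLowerRegular) (hA : AverageTailFraction)
    (hF : FloorRatioLimit) (hU : UniformModulus) (hE : BoundaryUniversality) : Crux :=
  HexConjecture_of_windowTwoPoint hF (windowTwoPointLowerBound_of_reg (triDlLowerRegular_of hP hPB hBR hA)) hU hE

/-- THE SKELETON THEOREM for the strategist's route decl `SAWBrickWallHomotopy.HexConjecture` (rank-2 load-bearing binder `hH` of its
`closes`): the crux BY NAME from the seven registered stubs, no other hypothesis.  (First theorem of the file concluding this decl.) -/
theorem HexConjecture_proof : Summit.CriticalPhenomena.SAWScalingLimit.Theses.SAWBrickWallHomotopy.HexConjecture :=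
  HexConjecture_of stub_halfPlaneGramPositivity stub_bochnerIneq_of_positivity stub_reg_of_bochner_avgTail
    stub_averageTailFraction stub_floorRatioLimit stub_uniformModulus stub_boundaryUniversality

/-- THE SKELETON THEOREM for the item's registered `crux_decl` `SAWHexUniversality.HexConjecture` (identical body; first theorem of the
file concluding this decl). -/
theorem HexConjecture_proof' : Summit.CriticalPhenomena.SAWScalingLimit.Theses.SAWHexUniversality.HexConjecture :=
  HexConjecture_proof

/-- Same for the `SAWDevelopingMap` decl. -/
theorem HexConjecture_proof'' : Summit.CriticalPhenomena.SAWScalingLimit.Theses.SAWDevelopingMap.HexConjecture :=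
  HexConjecture_proof

end Summit.CriticalPhenomena.SAWScalingLimit.Cruxes.HexConjecture.BoundaryGramBochnerRegularity

end
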